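import Literature.AlgebraicGeometry.Resolution.IdealIntegralClosure
import Mathlib.RingTheory.Valuation.LocalSubring
import Mathlib.Data.Fintype.Lattice
import HarnessLib

/-!
# The valuative criterion for integral dependence on an ideal; the normalized-blow-up chart criterion

Topic `Literature/AlgebraicGeometry/Resolution` (sibling of `IdealIntegralClosure.lean`; the elementwise
notion is the tree's `Hironaka2005.IsIntegralOverIdeal I x` = «`xᴺ + c₁xᴺ⁻¹ + ⋯ + c_N = 0`, `c_j ∈ Iʲ`»,
[Hironaka2005] [F5] p.95, Huneke–Swanson Def. 1.1.1). Everything here is PROVED; no definitions, no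
named facts.

* `IsIntegralOverIdeal.exists_mem_valuation_le` — **easy half of the valuative criterion, for an
  arbitrary commutative ring**: if `x` is integral over `I` then for EVERY valuation `v` of `A` there is
  `a ∈ I` with `v x ≤ v a` (for the valuation of a valuation ring `V ⊇ A`: «`x ∈ I·V`»; Huneke–Swanson
  Prop. 6.8.1: ideals of a valuation ring are integrally closed). Corollary
  `….exists_mem_valuationSubring_le` for valuation rings of a field `K` over `A`.
* `isIntegralOverIdeal_of_forall_valuationSubring` — **hard half** (Huneke–Swanson Prop. 6.8.2 /
  Thm. 6.8.3, valuative criterion): `A ↪ K` a subring of a field; if for every valuation ring `V` of `K`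
  containing `A` one has `x ∈ I·V`, then `x` is integral over `I`. Printed proof: `S = A[I/x]`, the ideal
  `(I/x)S` is either the unit ideal — which, `S` being the image of the Rees algebra `A[It]` under
  `t ↦ 1/x`, is an equation of integral dependence — or proper, and then Chevalley's extension theorem
  (Mathlib `Ideal.image_subset_nonunits_valuationSubring`) produces a valuation ring in which every
  `a/x`, `a ∈ I`, is a non-unit. Iff form `isIntegralOverIdeal_iff_forall_valuationSubring`.
* `valuation_le_one_of_isIntegral` — a valuation bounded by `1` on a subalgebra is bounded by `1` on
  every element integral over it (valuation rings are integrally closed; H–S Prop. 6.8.14 direction ⊆).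
* `isIntegralOverIdeal_pow_of_forall_isIntegral_div_pow` — **the normalized-blow-up chart criterion**:
  `J = (f_i)_{i ∈ ι}` finitely generated with some `f_i ≠ 0` in `K`; if for every `i` with `f_i ≠ 0` the
  element `g / f_i^μ` is INTEGRAL over the `i`-th blow-up chart ring `A[f_j/f_i : j] ⊆ K` (i.e. `g` lies in
  `f_i^μ · B_i`, `B_i` = integral closure of the chart ring in `K` = the `i`-th chart of the normalized
  blow-up of `J`), then `g` is integral over `J^μ` (pick a valuation ring `V ⊇ A`, a generator `f_{i₀}` of
  maximal value; then `A[J/f_{i₀}] ⊆ V`, hence `B_{i₀} ⊆ V`, so `v g ≤ v f_{i₀}^μ` with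
  `f_{i₀}^μ ∈ J^μ`). Converse `IsIntegralOverIdeal.isIntegral_div_pow` (an equation over `J^μ` divided
  by `f_i^{μN}` is a monic equation over the chart ring), so the integral closure of `J^μ` is EXACTLY
  the intersection of the contractions of the `f_i^μ B_i` (cf. H–S Prop. 5.2.4 for the Rees-algebra form).

## Why it is here

Cell `res-hironaka`, the residual literature premise «(♭)⊆» of [Hironaka2005] §12 (p.125 l.63–70:
`J_max(b!μ)` is contained in the integral closure of `(J♯)^μ`; tree shape = the hypothesis of
`Hironaka2005.jmax_flat_of_le`, `Hironaka2005CalPOfFlat.lean`): its printed proof runs through the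
charts of the normalized blow-up of `J♯` — the chart criterion above is the reduction step «S3» of the
sizing note `plan/tools/res-type-089/SIZING-F21e-flat.md` (there stated via graded saturation; here via
valuations, which avoids module-finiteness of the normalisation).

## Sources

* [HunekeSwanson2006] C. Huneke, I. Swanson, *Integral Closure of Ideals, Rings, and Modules*, LMS LN 336
  (2006): Prop. 6.8.1, Prop. 6.8.2 (proof with `S = R[I/r]`), Thm. 6.8.3 (valuative criterion),
  Prop. 6.8.14, Prop. 5.2.4; read on `lit galaxy read panama:308730839171157` chunks p0154–p0155.
* [Hironaka2005] H. Hironaka, Sémin. Congr. 10 (2005), [F5] p.95 (the notion), §12 pp.124–126 (consumer).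

#harness_tags commutative_algebra.integral_closure, commutative_algebra.valuations
-/

noncomputable section

open Polynomial

namespace Literature.AlgebraicGeometry.Resolution

namespace Hironaka2005

/-! ### The easy half: ideals of valuation rings are integrally closed -/

section Easy

variable {A : Type*} [CommRing A] {Γ₀ : Type*} [LinearOrderedCommGroupWithZero Γ₀]

/-- If a valuation `v` of `A` satisfies `v a < g` for all `a ∈ I` (`g ≠ 0`), then `v y < g ^ j` for
every `y ∈ I ^ j`, `j ≥ 1` (`I ^ j` is additively generated by products `m·n`, `m ∈ I ^ (j-1)`, `n ∈ I`).
(Plumbing.) [folklore] -/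
private theorem valuation_lt_pow_of_mem_pow (v : Valuation A Γ₀) {I : Ideal A} {g : Γ₀}
    (hg : g ≠ 0) (hI : ∀ a ∈ I, v a < g) {j : ℕ} (hj : 0 < j) {y : A} (hy : y ∈ I ^ j) :
    v y < g ^ j := by
  induction j, hj using Nat.le_induction generalizing y with
  | base => rw [pow_one] at hy ⊢; exact hI y hy
  | succ j hj ih =>
    rw [pow_succ] at hy
    refine Submodule.mul_induction_on hy (fun m hm n hn => ?_) (fun y z hy hz => v.map_add_lt hy hz)
    rw [map_mul, pow_succ]
    have hm' : v m < g ^ j := ih hm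
    have hn' : v n < g := hI n hn
    rcases eq_or_ne (v n) 0 with h0 | h0
    · rw [h0, mul_zero]
      exact zero_lt_iff.mpr (mul_ne_zero (pow_ne_zero _ hg) hg)
    · calc v m * v n < g ^ j * v n := mul_lt_mul_of_pos_right hm' (zero_lt_iff.mpr h0)
        _ ≤ g ^ j * g := mul_le_mul' le_rfl hn'.le

/-- **Easy half of the valuative criterion** (ideals of valuation rings are integrally closed): if `x`
is integral over `I`, then for EVERY valuation `v` of `A` there is `a ∈ I` with `v x ≤ v a` — for the
valuation of a valuation ring `V ⊇ A` this reads `x ∈ I·V`. Any commutative ring, any ideal, no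
boundedness of `v` on `A` needed (the hypothesis ranges over the whole ideal). [cite: HunekeSwanson2006, Prop. 6.8.1] -/
theorem IsIntegralOverIdeal.exists_mem_valuation_le (v : Valuation A Γ₀)
    {I : Ideal A} {x : A} (hx : IsIntegralOverIdeal I x) : ∃ a ∈ I, v x ≤ v a := by
  by_contra hcon'
  have hcon : ∀ a ∈ I, v a < v x := fun a ha => not_le.mp fun hle => hcon' ⟨a, ha, hle⟩
  -- in particular `0 < v x`
  have hx0 : v x ≠ 0 := by
    have h := hcon 0 I.zero_mem
    rw [map_zero] at h
    exact ne_of_gt h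
  obtain ⟨N, c, hN, hc, heq⟩ := hx
  have hlt : v (∑ j ∈ Finset.Icc 1 N, c j * x ^ (N - j)) < v x ^ N := by
    refine v.map_sum_lt (pow_ne_zero N hx0) fun j hj => ?_
    have hj' : 1 ≤ j ∧ j ≤ N := Finset.mem_Icc.mp hj
    rw [map_mul, map_pow]
    have hcj : v (c j) < v x ^ j := valuation_lt_pow_of_mem_pow v hx0 hcon hj'.1 (hc j hj)
    calc v (c j) * v x ^ (N - j) < v x ^ j * v x ^ (N - j) :=
          mul_lt_mul_of_pos_right hcj (pow_pos (zero_lt_iff.mpr hx0) _)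
      _ = v x ^ N := by rw [← pow_add, Nat.add_sub_cancel' hj'.2]
  have hxN : x ^ N = -∑ j ∈ Finset.Icc 1 N, c j * x ^ (N - j) := eq_neg_of_add_eq_zero_left heq
  have hv' : v x ^ N = v (∑ j ∈ Finset.Icc 1 N, c j * x ^ (N - j)) := by
    rw [← map_pow, hxN, Valuation.map_neg]
  exact lt_irrefl _ (hv' ▸ hlt)

variable {K : Type*} [Field K] [Algebra A K]

/-- **Easy half, field form**: `x` integral over `I` and `V` a valuation ring of a field `K` over `A`
⇒ `v(x) ≤ v(a)` for some `a ∈ I` (for `V ⊇ A`: `x ∈ I·V`). [cite: HunekeSwanson2006, Prop. 6.8.1] -/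
theorem IsIntegralOverIdeal.exists_mem_valuationSubring_le (V : ValuationSubring K)
    {I : Ideal A} {x : A} (hx : IsIntegralOverIdeal I x) :
    ∃ a ∈ I, V.valuation (algebraMap A K x) ≤ V.valuation (algebraMap A K a) :=
  hx.exists_mem_valuation_le (V.valuation.comap (algebraMap A K))

/-- A valuation of a field `K` that is `≤ 1` on an `A`-subalgebra `S ⊆ K` is `≤ 1` on every element of
`K` integral over `S` (valuation rings are integrally closed). [cite: HunekeSwanson2006, Prop. 6.8.14] -/
theorem valuation_le_one_of_isIntegral (v : Valuation K Γ₀) {S : Subalgebra A K}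
    (hS : ∀ s ∈ S, v s ≤ 1) {y : K} (hy : IsIntegral S y) : v y ≤ 1 := by
  by_contra hcon
  rw [not_le] at hcon
  obtain ⟨p, hmon, hp⟩ := hy
  have hy0 : v y ≠ 0 := ne_of_gt (lt_trans zero_lt_one hcon)
  -- `y ^ n = -(Σ_{i < n} (coeff i) y^i)`
  rw [eval₂_eq_sum_range, Finset.sum_range_succ, hmon.coeff_natDegree, map_one, one_mul] at hp
  set n := p.natDegree with hn
  have hyn : y ^ n = -∑ i ∈ Finset.range n, algebraMap S K (p.coeff i) * y ^ i :=
    eq_neg_of_add_eq_zero_right hp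
  have hlt : v (∑ i ∈ Finset.range n, algebraMap S K (p.coeff i) * y ^ i) < v y ^ n := by
    refine v.map_sum_lt (pow_ne_zero n hy0) fun i hi => ?_
    have hi' : i < n := Finset.mem_range.mp hi
    rw [map_mul, map_pow]
    calc v (algebraMap S K (p.coeff i)) * v y ^ i ≤ 1 * v y ^ i :=
          mul_le_mul' (hS _ (p.coeff i).2) le_rfl
      _ = v y ^ i := one_mul _
      _ < v y ^ n := pow_lt_pow_right₀ hcon hi'
  have hv' : v y ^ n = v (∑ i ∈ Finset.range n, algebraMap S K (p.coeff i) * y ^ i) := by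
    rw [← map_pow, hyn, Valuation.map_neg]
  exact lt_irrefl _ (hv' ▸ hlt)

end Easy

/-! ### The hard half: Chevalley extension -/

section Hard

variable {A : Type*} [CommRing A] {K : Type*} [Field K] [Algebra A K]

/-- **Valuative criterion, hard half** (Huneke–Swanson Prop. 6.8.2 / Thm. 6.8.3): let `A ↪ K` be a
subring of a field. If for every valuation ring `V` of `K` containing `A` there is `a ∈ I` with
`v(x) ≤ v(a)` («`x ∈ I·V`»), then `x` is integral over `I`. Proof as printed: `S = A[I/x]` is the image
of the Rees algebra `A[It]` under `t ↦ 1/x`; if the ideal `(I/x)S` is the unit ideal, clearing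
denominators in `1 ∈ (I/x)S` gives an equation of integral dependence; otherwise a valuation ring
`V ⊇ S` with `(I/x)S ⊆ 𝔪_V` (Chevalley) violates the hypothesis. [cite: HunekeSwanson2006, Prop. 6.8.2] -/
theorem isIntegralOverIdeal_of_forall_valuationSubring (hinj : Function.Injective (algebraMap A K))
    {I : Ideal A} {x : A}
    (h : ∀ V : ValuationSubring K, (∀ a, algebraMap A K a ∈ V) →
      ∃ a ∈ I, V.valuation (algebraMap A K x) ≤ V.valuation (algebraMap A K a)) :
    IsIntegralOverIdeal I x := by
  classical
  set x' : K := algebraMap A K x with hx'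
  by_cases hx0 : x' = 0
  · have : x = 0 := hinj (by rw [map_zero]; exact hx0)
    rw [this]; exact IsIntegralOverIdeal.zero I
  by_contra hnot
  -- the Rees algebra evaluated at `t = 1/x`
  let φ : reesAlgebra I →ₐ[A] K := (aeval x'⁻¹).comp (reesAlgebra I).val
  have hφ : ∀ q : reesAlgebra I, φ q = aeval x'⁻¹ (q : A[X]) := fun q => rfl
  -- `S = A[I/x]`, as a subring of `K`
  let T : Set K := (fun a : A => algebraMap A K a / x') '' (I : Set A)
  let S : Subalgebra A K := Algebra.adjoin A T
  have hST : S ≤ φ.range := by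
    refine Algebra.adjoin_le ?_
    rintro _ ⟨a, ha, rfl⟩
    refine ⟨⟨monomial 1 a, reesAlgebra.monomial_mem.mpr (by rwa [pow_one])⟩, ?_⟩
    show aeval x'⁻¹ (monomial 1 a) = algebraMap A K a / x'
    rw [aeval_monomial, pow_one, div_eq_mul_inv]
  let R : Subring K := S.toSubring
  -- the ideal `(I/x) S`
  let gen : I → R := fun a => ⟨algebraMap A K a / x', Algebra.subset_adjoin ⟨a, a.2, rfl⟩⟩
  let J : Ideal R := Ideal.span (Set.range gen)
  -- every element of `J` is `q(1/x)` for some `q ∈ A[It]` with vanishing constant term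
  have hJ : ∀ u ∈ J, ∃ q : reesAlgebra I, (q : A[X]).coeff 0 = 0 ∧ φ q = (u : K) := by
    intro u hu
    refine Submodule.span_induction (p := fun (u : R) _ => ∃ q : reesAlgebra I,
      (q : A[X]).coeff 0 = 0 ∧ φ q = ((u : R) : K)) ?_ ?_ ?_ ?_ hu
    · rintro _ ⟨a, rfl⟩
      refine ⟨⟨monomial 1 (a : A), reesAlgebra.monomial_mem.mpr (by rw [pow_one]; exact a.2)⟩, ?_, ?_⟩
      · exact coeff_monomial_of_ne _ zero_ne_one
      · show aeval x'⁻¹ (monomial 1 (a : A)) = algebraMap A K a / x'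
        rw [aeval_monomial, pow_one, div_eq_mul_inv]
    · exact ⟨0, by simp, by simp⟩
    · rintro u w - - ⟨q₁, hq₁, hq₁'⟩ ⟨q₂, hq₂, hq₂'⟩
      refine ⟨q₁ + q₂, ?_, ?_⟩
      · rw [Subalgebra.coe_add, coeff_add, hq₁, hq₂, add_zero]
      · rw [map_add, hq₁', hq₂', Subring.coe_add]
    · rintro r u - ⟨q, hq, hq'⟩
      obtain ⟨s, hs⟩ := (AlgHom.mem_range φ).mp (hST r.2)
      refine ⟨s * q, ?_, ?_⟩
      · rw [Subalgebra.coe_mul, mul_coeff_zero, hq, mul_zero]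
      · rw [map_mul, hs, hq', smul_eq_mul, Subring.coe_mul]
  -- `J` is a proper ideal: otherwise an equation of integral dependence
  have hJtop : J ≠ ⊤ := by
    intro htop
    obtain ⟨q, hq0, hq1⟩ := hJ 1 ((Ideal.eq_top_iff_one J).mp htop)
    have hq1' : aeval x'⁻¹ (q : A[X]) = 1 := by rw [← hφ, hq1, Subring.coe_one]
    set p : A[X] := (q : A[X]) with hp
    have hpI : ∀ k, p.coeff k ∈ I ^ k := (mem_reesAlgebra_iff I p).mp q.2
    set N := p.natDegree with hN
    have hN0 : 0 < N := by
      by_contra h0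
      have h0' : p.natDegree = 0 := by omega
      have hp0 : p = 0 := by rw [eq_C_of_natDegree_eq_zero h0', hq0, map_zero]
      rw [hp0, map_zero] at hq1'
      exact zero_ne_one hq1'
    -- clear denominators: `x'^N = Σ_{k ≤ N} coeff_k x'^{N-k}`
    have hsum : x' ^ N = ∑ k ∈ Finset.range (N + 1), algebraMap A K (p.coeff k) * x' ^ (N - k) := by
      have h1 : x' ^ N * aeval x'⁻¹ p = x' ^ N := by rw [hq1', mul_one]
      rw [← h1, aeval_eq_sum_range, Finset.mul_sum]
      refine Finset.sum_congr rfl fun k hk => ?_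
      have hkN : k ≤ N := Nat.lt_succ_iff.mp (Finset.mem_range.mp hk)
      rw [Algebra.smul_def, mul_left_comm, inv_pow, ← pow_sub₀ _ hx0 hkN]
    -- split off the (vanishing) constant term
    rw [Finset.range_eq_Ico, Finset.sum_eq_sum_Ico_succ_bot (Nat.succ_pos N), hq0, map_zero,
      zero_mul, zero_add, Nat.zero_add, Nat.succ_eq_add_one] at hsum
    apply hnot
    refine ⟨N, fun k => -p.coeff k, hN0, fun k _ => neg_mem (hpI k), hinj ?_⟩
    rw [map_zero, map_add, map_pow, map_sum, ← hx', hsum,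
      show Finset.Icc 1 N = Finset.Ico 1 (N + 1) from rfl, ← Finset.sum_add_distrib]
    refine Finset.sum_eq_zero fun k _ => ?_
    rw [map_mul, map_pow, map_neg, ← hx', neg_mul, add_neg_cancel]
  -- Chevalley: a valuation ring `V ⊇ S` in which every `a/x`, `a ∈ I`, is a non-unit
  obtain ⟨V, hRV, hJV⟩ := Ideal.image_subset_nonunits_valuationSubring J hJtop
  have hAV : ∀ a, algebraMap A K a ∈ V := fun a => hRV (S.algebraMap_mem a)
  obtain ⟨a, haI, hle⟩ := h V hAV
  have hmem : algebraMap A K a / x' ∈ V.nonunits :=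
    hJV ⟨gen ⟨a, haI⟩, Ideal.subset_span ⟨⟨a, haI⟩, rfl⟩, rfl⟩
  rw [ValuationSubring.mem_nonunits_iff, map_div₀] at hmem
  have hvx : 0 < V.valuation x' := zero_lt_iff.mpr ((Valuation.ne_zero_iff _).mpr hx0)
  have hlt : V.valuation (algebraMap A K a) < V.valuation x' := (div_lt_one₀ hvx).mp hmem
  exact absurd hle (not_le.mpr hlt)

/-- **Valuative criterion for integral dependence on an ideal** (iff form): for a subring `A ↪ K` of a
field, `x` is integral over `I` iff `x ∈ I·V` (i.e. `v(x) ≤ v(a)` for some `a ∈ I`) for every valuation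
ring `V` of `K` containing `A`. [cite: HunekeSwanson2006, Prop. 6.8.2 / Thm. 6.8.3] -/
theorem isIntegralOverIdeal_iff_forall_valuationSubring (hinj : Function.Injective (algebraMap A K))
    {I : Ideal A} {x : A} :
    IsIntegralOverIdeal I x ↔ ∀ V : ValuationSubring K, (∀ a, algebraMap A K a ∈ V) →
      ∃ a ∈ I, V.valuation (algebraMap A K x) ≤ V.valuation (algebraMap A K a) :=
  ⟨fun hx V _ => hx.exists_mem_valuationSubring_le V,
    isIntegralOverIdeal_of_forall_valuationSubring hinj⟩

end Hard

/-! ### The normalized-blow-up chart criterion -/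

section Charts

variable {A : Type*} [CommRing A] {K : Type*} [Field K] [Algebra A K]

/-- **Chart criterion** (reduction to the charts of the normalized blow-up): `J = (f_i)_{i∈ι}` finitely
generated with some `f_i ≠ 0` in `K`. If for every `i` with `f_i ≠ 0` the element `g / f_i^μ ∈ K` is
integral over the `i`-th blow-up chart ring `A[f_j/f_i : j ∈ ι] ⊆ K` — i.e. `g ∈ f_i^μ · B_i` with `B_i`
the integral closure of the chart ring in `K` — then `g` is integral over `J^μ`. (For a valuation ring
`V ⊇ A` pick `i₀` with `v(f_{i₀})` maximal: then `A[J/f_{i₀}] ⊆ V`, so `B_{i₀} ⊆ V` and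
`v(g) ≤ v(f_{i₀}^μ)`, `f_{i₀}^μ ∈ J^μ`; conclude by the valuative criterion.)
[cite: HunekeSwanson2006, Prop. 6.8.2 with Prop. 5.2.4] -/
theorem isIntegralOverIdeal_pow_of_forall_isIntegral_div_pow
    (hinj : Function.Injective (algebraMap A K)) {ι : Type*} [Finite ι] (f : ι → A)
    (hf : ∃ i, algebraMap A K (f i) ≠ 0) {μ : ℕ} {g : A}
    (h : ∀ i, algebraMap A K (f i) ≠ 0 →
      IsIntegral (Algebra.adjoin A (Set.range fun j => algebraMap A K (f j) / algebraMap A K (f i)))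
        (algebraMap A K g / algebraMap A K (f i) ^ μ)) :
    IsIntegralOverIdeal (Ideal.span (Set.range f) ^ μ) g := by
  classical
  refine isIntegralOverIdeal_of_forall_valuationSubring hinj fun V hAV => ?_
  obtain ⟨i₁, hi₁⟩ := hf
  haveI : Nonempty ι := ⟨i₁⟩
  let v := V.valuation
  obtain ⟨i₀, hi₀⟩ := Finite.exists_max fun i => v (algebraMap A K (f i))
  have hv₁ : 0 < v (algebraMap A K (f i₁)) := zero_lt_iff.mpr ((Valuation.ne_zero_iff _).mpr hi₁)
  have hv₀ : 0 < v (algebraMap A K (f i₀)) := lt_of_lt_of_le hv₁ (hi₀ i₁)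
  have hf₀ : algebraMap A K (f i₀) ≠ 0 := (Valuation.ne_zero_iff _).mp (ne_of_gt hv₀)
  -- the `i₀`-chart ring lies in `V`
  set S := Algebra.adjoin A (Set.range fun j => algebraMap A K (f j) / algebraMap A K (f i₀)) with hS
  have hSV : ∀ s ∈ S, v s ≤ 1 := by
    intro s hs
    let V' : Subalgebra A K :=
      { V.toSubring with
        algebraMap_mem' := hAV }
    have hle : S ≤ V' := by
      refine Algebra.adjoin_le ?_
      rintro _ ⟨j, rfl⟩
      show algebraMap A K (f j) / algebraMap A K (f i₀) ∈ V
      rw [← V.valuation_le_one_iff, map_div₀]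
      exact (div_le_one₀ hv₀).mpr (hi₀ j)
    exact (V.valuation_le_one_iff _).mpr (hle hs)
  have hy : v (algebraMap A K g / algebraMap A K (f i₀) ^ μ) ≤ 1 :=
    valuation_le_one_of_isIntegral v hSV (h i₀ hf₀)
  refine ⟨f i₀ ^ μ, Ideal.pow_mem_pow (Ideal.subset_span (Set.mem_range_self i₀)) μ, ?_⟩
  rw [map_div₀, map_pow] at hy
  rw [map_pow, map_pow]
  exact (div_le_one₀ (pow_pos hv₀ μ)).mp hy

/-- **The blow-up chart ring contains `J^m / f_i^m`**: for `c ∈ J^m`, `J = (f_j)_j`, the quotient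
`c / f_i^m ∈ K` lies in the `i`-th affine chart ring `A[f_j/f_i : j]` of the blow-up of `J` (the degree-`0`
part of `A[Jt]` localised at `f_i t`; the `Spec A[J/f_i]` cover `Bl_J(A)`). [cite: HunekeSwanson2006, Def. 5.6.2] -/
theorem div_pow_mem_adjoin_of_mem_pow {ι : Type*} (f : ι → A) (i : ι) {m : ℕ} {c : A}
    (hc : c ∈ Ideal.span (Set.range f) ^ m) :
    algebraMap A K c / algebraMap A K (f i) ^ m ∈
      Algebra.adjoin A (Set.range fun j => algebraMap A K (f j) / algebraMap A K (f i)) := by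
  set S := Algebra.adjoin A (Set.range fun j => algebraMap A K (f j) / algebraMap A K (f i)) with hS
  set d : K := algebraMap A K (f i) with hd
  induction m generalizing c with
  | zero =>
    rw [pow_zero, div_one]
    exact S.algebraMap_mem c
  | succ m ih =>
    rw [pow_succ] at hc
    refine Submodule.mul_induction_on hc (fun c₁ hc₁ e he => ?_) (fun y z hy hz => ?_)
    · rw [map_mul, pow_succ, mul_div_mul_comm]
      refine S.mul_mem (ih hc₁) ?_
      -- `e ∈ J ⇒ e/d ∈ S`
      refine Submodule.span_induction (p := fun e _ => algebraMap A K e / d ∈ S) ?_ ?_ ?_ ?_ he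
      · rintro _ ⟨j, rfl⟩
        exact Algebra.subset_adjoin ⟨j, rfl⟩
      · rw [map_zero, zero_div]; exact S.zero_mem
      · intro y z _ _ hy hz
        rw [map_add, add_div]; exact S.add_mem hy hz
      · intro r y _ hy
        rw [smul_eq_mul, map_mul, mul_div_assoc]
        exact S.mul_mem (S.algebraMap_mem r) hy
    · rw [map_add, add_div]; exact S.add_mem hy hz

/-- **Converse of the chart criterion**: if `g` is integral over `J^μ`, `J = (f_j)_j`, then for every
generator `f_i` invertible in `K` the element `g / f_i^μ` is integral over the chart ring `A[f_j/f_i : j]`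
(divide an equation `gᴺ + Σ c_k gᴺ⁻ᵏ = 0`, `c_k ∈ J^{μk}`, by `f_i^{μN}`). Together with
`isIntegralOverIdeal_pow_of_forall_isIntegral_div_pow`: the integral closure of `J^μ` in `A` is exactly
the intersection of the contractions of `f_i^μ · B_i`, `B_i` the integral closure of the `i`-th chart.
[cite: HunekeSwanson2006, Prop. 5.2.4] -/
theorem IsIntegralOverIdeal.isIntegral_div_pow {ι : Type*} (f : ι → A) {μ : ℕ} {g : A}
    (hg : IsIntegralOverIdeal (Ideal.span (Set.range f) ^ μ) g) {i : ι}
    (hi : algebraMap A K (f i) ≠ 0) :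
    IsIntegral (Algebra.adjoin A (Set.range fun j => algebraMap A K (f j) / algebraMap A K (f i)))
      (algebraMap A K g / algebraMap A K (f i) ^ μ) := by
  classical
  set S := Algebra.adjoin A (Set.range fun j => algebraMap A K (f j) / algebraMap A K (f i)) with hS
  set d : K := algebraMap A K (f i) with hd
  set y : K := algebraMap A K g / d ^ μ with hy
  obtain ⟨N, c, hN, hc, heq⟩ := hg
  -- coefficients `c_k / d^{μk} ∈ S`
  have hcS : ∀ k ∈ Finset.Icc 1 N, algebraMap A K (c k) / d ^ (μ * k) ∈ S := fun k hk => by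
    have := div_pow_mem_adjoin_of_mem_pow (K := K) f i (m := μ * k) (c := c k) (by rw [pow_mul]; exact hc k hk)
    exact this
  let a : ℕ → S := fun k =>
    if hk : k ∈ Finset.Icc 1 N then ⟨algebraMap A K (c k) / d ^ (μ * k), hcS k hk⟩ else 0
  let q : S[X] := ∑ k ∈ Finset.Icc 1 N, C (a k) * X ^ (N - k)
  have hq : q.degree < N := by
    refine lt_of_le_of_lt (degree_sum_le _ _) ?_
    refine (Finset.sup_lt_iff (WithBot.bot_lt_coe N)).mpr fun k hk => ?_
    refine lt_of_le_of_lt (degree_C_mul_X_pow_le _ _) ?_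
    have hk1 : 1 ≤ k ∧ k ≤ N := Finset.mem_Icc.mp hk
    have : N - k < N := by omega
    exact WithBot.coe_lt_coe.mpr this
  refine ⟨X ^ N + q, monic_X_pow_add hq, ?_⟩
  have hd0 : d ^ (μ * N) ≠ 0 := pow_ne_zero _ hi
  -- `eval (X^N + q) y · d^{μN} = g^N + Σ c_k g^{N-k} = 0`
  have hterm : ∀ k ∈ Finset.Icc 1 N,
      algebraMap S K (a k) * y ^ (N - k) = algebraMap A K (c k * g ^ (N - k)) / d ^ (μ * N) := by
    intro k hk
    have hkN : k ≤ N := (Finset.mem_Icc.mp hk).2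
    simp only [a, dif_pos hk]
    change algebraMap A K (c k) / d ^ (μ * k) * y ^ (N - k) = _
    rw [hy, div_pow, ← pow_mul, div_mul_div_comm, ← pow_add, map_mul, map_pow,
      show μ * k + μ * (N - k) = μ * N by rw [← Nat.mul_add, Nat.add_sub_cancel' hkN]]
  have heval : eval₂ (algebraMap S K) y (X ^ N + q) * d ^ (μ * N) =
      algebraMap A K (g ^ N + ∑ k ∈ Finset.Icc 1 N, c k * g ^ (N - k)) := by
    simp only [q, eval₂_add, eval₂_pow, eval₂_X, eval₂_finsetSum, eval₂_mul, eval₂_C]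
    rw [add_mul, Finset.sum_mul, map_add, map_sum]
    congr 1
    · rw [hy, div_pow, ← pow_mul, map_pow, div_mul_cancel₀ _ hd0]
    · refine Finset.sum_congr rfl fun k hk => ?_
      rw [hterm k hk, div_mul_cancel₀ _ hd0]
  have h0 : eval₂ (algebraMap S K) y (X ^ N + q) * d ^ (μ * N) = 0 := by
    rw [heval, heq, map_zero]
  exact (mul_eq_zero.mp h0).resolve_right hd0

end Charts

end Hironaka2005

end Literature.AlgebraicGeometry.Resolution

end
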